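import Mathlib
import Literature.MathematicalPhysics.QuantumLattice.EuclideanAction

/-!
# Sketch — crux-ideate stmt-QuantumFields-11685 (ShellRigidity), ideator 3, round 1

First lemmas of the two idea cards, stated over Mathlib + the tree (no sorry in statements;
these are `def … : Prop`, not claims).

* `rot01 φ x` — rotation by angle `φ` in the `(x₀,x₁)` coordinate plane of `ℝ⁴`.
* `Hyp16 a K` — the hypothesis package of `PencilRigidity.ShellRigidity` with a general UV
  exponent `a` in place of `10 − η` (continuity off `0`, `|K x| ≤ C (1 + ‖x‖^(−a))`,
  `W(B₄)`-invariance, pointwise OS-positivity across `x₀ = 0` and across `x₀ = x₁`).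
* card `thales-slit-exact-cone-type`:
  `ThalesSlitEstimate` (first lemma) and `AngleTypeBound` (the lever's output).
* card `null-family-sign-test`:
  `BandLimitedShellRigidity` (transfer target = the crux for `SO(4)`-finite kernels) and
  `P4P6NullIndefinite` (the two explicit sign facts that kill harmonic degrees 4 and 6).
-/

open Literature.MathematicalPhysics.QuantumLattice
open scoped BigOperators

namespace Summit.QuantumFields.YangMills.Cruxes.ShellRigidity.Ideator3

/-- Local abbreviation for Euclidean `ℝ⁴`. -/
abbrev E4 := EuclideanSpace ℝ (Fin 4)

/-- Rotation by the real angle `φ` in the `(0,1)` coordinate plane. -/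
noncomputable def rot01 (φ : ℝ) (x : E4) : E4 :=
  WithLp.toLp 2 ![Real.cos φ * x 0 - Real.sin φ * x 1, Real.sin φ * x 0 + Real.cos φ * x 1, x 2, x 3]

/-- The point `t e₀ + w e₁ + x₂ e₂ + x₃ e₃` with a COMPLEX second coordinate `w`, encoded as the
pair (real vector with `Re w`, imaginary part `Im w`): we only ever need the real trace
`u ↦ K (t, u, x₂, x₃)`, so we package it as a real vector. -/
noncomputable def pt (t u x₂ x₃ : ℝ) : E4 := WithLp.toLp 2 ![t, u, x₂, x₃]

/-- Hypothesis package of `ShellRigidity` with a general UV exponent `a` (the crux has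
`a = 10 − η`, `η > 0`): continuity off the origin, the growth bound, invariance under all signed
permutations, pointwise OS-positivity across `x₀ = 0` and across `x₀ = x₁`. -/
def Hyp16 (a : ℝ) (K : E4 → ℝ) : Prop :=
  ContinuousOn K {x : E4 | x ≠ 0} ∧
  (∃ C : ℝ, ∀ x : E4, x ≠ 0 → |K x| ≤ C * (1 + ‖x‖ ^ (-a))) ∧
  (∀ R : E4 ≃ₗᵢ[ℝ] E4, (∀ i : Fin 4, ∃ j : Fin 4, R (EuclideanSpace.single i 1) =
      EuclideanSpace.single j 1 ∨ R (EuclideanSpace.single i 1) = -EuclideanSpace.single j 1) →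
    ∀ x : E4, K (R x) = K x) ∧
  (∀ (m : ℕ) (x : Fin m → E4) (c : Fin m → ℝ), (∀ i, 0 < x i 0) →
    0 ≤ ∑ i, ∑ j, c i * c j * K (timeReflection 4 (x i) - x j)) ∧
  (∀ (m : ℕ) (x : Fin m → E4) (c : Fin m → ℝ), (∀ i, x i 1 < x i 0) →
    0 ≤ ∑ i, ∑ j, c i * c j *
      K (LinearIsometryEquiv.piLpCongrLeft 2 ℝ ℝ (Equiv.swap (0 : Fin 4) 1) (x i) - x j))

/-- **First lemma of card `thales-slit-exact-cone-type` (Thales disc + slit estimate).**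
For `K` with `Hyp16 a K`, every `t > 0` and real spectators `x₂, x₃`, the real-analytic trace
`u ↦ K(t, u, x₂, x₃)` is the restriction of a function `G` holomorphic on
`{Re w ≠ 0} ∪ {|w| < t}` (off the imaginary axis: the `e₁`-Laplace representation; on the Thales
disc `|w| < t`: the Siciak–Zahariuta cross theorem applied to the two DIAGONAL Laplace
representations), and on the imaginary segment it obeys the slit estimate
`|G(iY)| ≤ C' (1 + (t − |Y|)^(−a))`, `|Y| < t` (log-subharmonic mean value on circles inside the
Thales disc, fed by `|G(ε + iσ)| ≤ K(ε e₁) ≤ C(1 + ε^(−a))`). -/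
def ThalesSlitEstimate : Prop :=
  ∀ (a : ℝ) (K : E4 → ℝ), 0 ≤ a → Hyp16 a K →
    ∃ C' : ℝ, ∀ (t x₂ x₃ : ℝ), 0 < t →
      ∃ G : ℂ → ℂ,
        DifferentiableOn ℂ G ({w : ℂ | w.re ≠ 0} ∪ Metric.ball (0 : ℂ) t) ∧
        (∀ u : ℝ, (u : ℂ).re ≠ 0 ∨ |u| < t → G u = K (pt t u x₂ x₃)) ∧
        ∀ Y : ℝ, |Y| < t → ‖G (Y * Complex.I)‖ ≤ C' * (1 + (t - |Y|) ^ (-a))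

/-- **Output of the lever of card `thales-slit-exact-cone-type` (angle type bound).**
For `K` with `Hyp16 a K` and every base point `x` off the rotation axis, the function
`φ ↦ K (rot01 φ x)` of the REAL rotation angle is the restriction of an ENTIRE function of
exponential type `≤ a`: `‖h φ‖ ≤ C' (1 + e^{a |Im φ|})` (the slit estimate + Landau's theorem give
the exact `ℓ∞` light cone of the axis Laplace measure, whose Laplace tube contains the whole
complex rotation orbit with margin `(R_α x)₀ e^{−|ψ|}`). With `a = 10 − η < 10` and the
`π/2`-periodicity from `W(B₄)` this leaves only the Fourier modes `0, ±4, ±8`. -/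
def AngleTypeBound : Prop :=
  ∀ (a : ℝ) (K : E4 → ℝ), 0 ≤ a → Hyp16 a K →
    ∀ x : E4, (x 0 ≠ 0 ∨ x 1 ≠ 0) →
      ∃ (h : ℂ → ℂ) (C' : ℝ), Differentiable ℂ h ∧
        (∀ φ : ℝ, h φ = K (rot01 φ x)) ∧
        (∀ φ : ℂ, h (φ + (Real.pi / 2 : ℝ)) = h φ) ∧
        ∀ φ : ℂ, ‖h φ‖ ≤ C' * (1 + Real.exp (a * |φ.im|))

/-- **Transfer target of card `null-family-sign-test`: the crux for `SO(4)`-finite kernels.**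
If, in addition to the hypotheses of `ShellRigidity` (here with `a = 10 − η`), `K` is a finite
sum of (radial function) × (polynomial) off the origin — equivalently its restrictions to spheres
span a finite-dimensional `SO(4)`-module, which is what `AngleTypeBound` + the Casimir count
deliver — then `K` is radial off the origin. -/
def BandLimitedShellRigidity : Prop :=
  ∀ (η : ℝ) (K : E4 → ℝ), 0 < η → η < 10 → Hyp16 (10 - η) K →
    (∃ (N : ℕ) (k : Fin N → ℝ → ℝ) (P : Fin N → MvPolynomial (Fin 4) ℝ),
      ∀ x : E4, x ≠ 0 → K x = ∑ j, k j ‖x‖ * MvPolynomial.eval (fun i => x i) (P j)) →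
    ∀ (R : E4 ≃ₗᵢ[ℝ] E4) (x : E4), x ≠ 0 → K (R x) = K x

/-- **First lemma of card `null-family-sign-test` (the two explicit sign facts).**
On the complex null vectors `i n + q` (`q ⊥ n`, `‖q‖ = 1`) attached to the diagonal root
`n = d = (e₀+e₁)/√2` the quartic invariant `p₄ = Σ k_μ⁴` takes both signs (values `−2` at
`q = d' = (e₀−e₁)/√2` and `3/2` at `q = e₂`), and the sextic `p₆ = Σ k_μ⁶` (which equals the
degree-6 invariant harmonic `h₆/16` on the null cone) is `> 0` at `i d + e₂` and `< 0` at the axis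
null vector `i e₀ + (e₁+e₂)/√2`. These kill harmonic degrees 4 and 6 as TOP harmonics of a
band-limited 16-RP kernel (large-`|k⊥|` dominance), leaving `ℓ_top = 0` (radial) or
`ℓ_top ≥ 8` (order `≥ ℓ_top + 2 ≥ 10`). -/
def P4P6NullIndefinite : Prop :=
  let s : ℂ := (Real.sqrt 2 : ℂ)⁻¹
  -- p₄ at i d + d'  (k₀ = (i+1)/√2, k₁ = (i−1)/√2, k₂ = k₃ = 0)
  ((s * (Complex.I + 1)) ^ 4 + (s * (Complex.I - 1)) ^ 4).re < 0 ∧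
  -- p₄ at i d + e₂  (k₀ = k₁ = i/√2, k₂ = 1)
  0 < ((s * Complex.I) ^ 4 + (s * Complex.I) ^ 4 + (1 : ℂ) ^ 4).re ∧
  -- p₆ at i d + e₂
  0 < ((s * Complex.I) ^ 6 + (s * Complex.I) ^ 6 + (1 : ℂ) ^ 6).re ∧
  -- p₆ at i e₀ + (e₁+e₂)/√2
  (Complex.I ^ 6 + (s : ℂ) ^ 6 + (s : ℂ) ^ 6).re < 0

end Summit.QuantumFields.YangMills.Cruxes.ShellRigidity.Ideator3
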